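import Summits.CriticalPhenomena.PercolationContinuityZ3.Theorems.Transplant.SkelNegBParamsSched
import Summits.CriticalPhenomena.PercolationContinuityZ3.Theorems.Transplant.SkelNegBParamsExcess
import Summits.CriticalPhenomena.PercolationContinuityZ3.Theorems.Transplant.SkelNegBParamsLO
import HarnessLib

/-!
# N1 params, chain of record `NegB`, part SlotsS: THE FIBRE-BLOCK SLOT VALUE OF RECORD `NegB.SR ex mx : NegB.SSlot` (the q-level `SchedIn` the schedule of record
# `schedOf … (SR …)` reads) — `rmax := max fcells.rmax (cOff + 1)` (hp-8 g33 2026-08-21T15:4xZ: `hgap20/hgapc/hgapR`), `u := 1`, `M := ψM := ψtop := 0`, `reachK := ex` (a RESIDUAL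
# floor slot for `L′`/`E₀`: any lower bound a residue posts later is a value of `ex`, not a file), `Rex := NegB.Rex (mR … mx) q` (part Excess: the monotone hull of the excess
# radius at planar diameter `mR := max (80·(n_L+ℓ_L+3|h_L|+1)·(50·fcells.rmax+1)) mx`), and every schedule-side binder of the three residues BY NAME

builds on p205010 (kernel theorem, internal audit signed; external expert review pending) — nothing in this file uses p205010; NOTHING is claimed about
the node `SamePDropOfSkeletonNeg₁` (OPEN).
Status sentence (coordinator 2026-08-20T04:30Z): "θ(p_c) = 0 on ℤ^d, all d ≥ 2 — kernel-verified (Lean 4/Mathlib, standard axioms); internal adversarial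
audit SIGNED 2026-08-20 04:29Z; external expert review pending."
Lane `prim-bschramm-*`, seat `prim-bschramm-stmt` (gen 14); helper file (`--supports stmt-CriticalPhenomena-4575 --as helper`); ledger HOME/prim-bschramm-stmt/NEG-PARAMS.md v0.12.
Reading: `Λ := schedOf κ Φ t p D g f (SR ex mx κ Φ t p D g f q) = Prm.schedN (SR …) fcells offN = concRadii2N fcells (Prm.gap S) 0 (Prm.E₀ S) (Prm.Lp S) offN` (`Prm.schedN_eq`).
* §1 `mR` (+ `mR_ge`), **`SR`**, `SR_fields` (rfl), `SR_rmax_ge` (`fcells.rmax ≤ rmax`, `cOff + 1 ≤ rmax`), `SR_Rex` (`= NegB.Rex (mR …) q`);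
* §2 the gap/E₀/L′ facts at `S := SR …`: **`hgap20_R`** (`20·fcells.rmax ≤ gap ρ`), **`hgapc_R`** (`cOff ≤ gap ρ`), **`hgapR_R`** (`cOff + 2L′ + Rex ρ + 2 ≤ gap ρ`), `hgapL_R`, `ex_le_Lp`,
  `Lp_le_E₀_R`, `three_le_E₀_R`, `hsch_R` (`Rex (E g + 1) + L′ ≤ E (g+1)`, from `Prm.hsch`), `schedOf_WFS2` (part ChoiceAll) — and `Rex_mono_R`;
* §3 the excess at the value: **`hR₁_R`/`hRex_R`** (parts Excess `hR₁_at/hRex_at` at `m := mR`), **`fine_diam_le_mR`** (F-diameter `≤ 50·fcells.rmax` fine cells ⇒ φ-diameter `≤ mR`: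
  the (C) residue's `hRex` box hypothesis discharged through `φ_extent_fine_at`).
[cite: KozmaNitzan2024, §4 Theorem 6 (pp. 25–31); Lemma 12 (p. 24)] [cite: MartineauTassion2017, §4.3]
-/

noncomputable section

open scoped Classical

namespace Summit.CriticalPhenomena.PercolationContinuityZ3.Theorems.Transplant

namespace PlanarSkeletonNeg

namespace NegB

open MeasureTheory Literature.Probability.Percolation Literature.Probability.LatticeModels SimpleGraph
open Literature.Barriers.CriticalPhenomena (graphBall)
open SkelConc (Consts)
open BoxProdZ2 (ConcRadiiG Erad)
open Skelφ (oriφ trφ)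
open Skelφ.StepI (DataN OutO)
open Skel (excess)
open Neg

/-! ## §1 The planar diameter and the fibre block of record -/

section Values

variable (κ : Consts) {V : Type} [DecidableEq V] [Countable V] {G : SimpleGraph V} [G.LocallyFinite] (Φ : PlanarSkeletonNeg G) (t : V)
  (p : unitInterval) (D : DataN V) (g f ex mx : ℕ)

/-- **The φ-diameter of a rim habitat** (residual slot `mx`): `mR := max (80·(n_L + ℓ_L + 3|h_L| + 1)·(50·fcells.rmax + 1)) mx` — the φ-extent of a fine extent `50·rmax` by
`φ_extent_fine_at`. [this work] -/
def mR : ℕ := max (80 * (nL κ Φ t p D g f + ℓL κ Φ t p D g f + 3 * (hL κ Φ t p D g f).natAbs + 1) * (50 * (fcells κ Φ t p D g f).rmax + 1)) mx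

/-- The two floors inside `mR`. [folklore] -/
theorem mR_ge : 80 * (nL κ Φ t p D g f + ℓL κ Φ t p D g f + 3 * (hL κ Φ t p D g f).natAbs + 1) * (50 * (fcells κ Φ t p D g f).rmax + 1) ≤ mR κ Φ t p D g f mx ∧
    mx ≤ mR κ Φ t p D g f mx := ⟨le_max_left _ _, le_max_right _ _⟩

end Values

/-- **THE FIBRE BLOCK OF RECORD** (residual slots `ex` for `L′/E₀`, `mx` for the excess diameter): `⟨max fcells.rmax (cOff+1), 1, 0, 0, 0, ex, NegB.Rex mR q⟩`.
[cite: KozmaNitzan2024, §4 Theorem 6 (pp. 25–31): the order of constants] -/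
def SR (ex mx : ℕ) : SSlot := fun κ _ _ _ _ _ Φ t p D g f q =>
  ⟨max (fcells κ Φ t p D g f).rmax (cOff κ Φ t p D g f + 1), 1, 0, 0, 0, ex, Rex κ Φ (mR κ Φ t p D g f mx) q⟩

section Facts

variable (κ : Consts) {V : Type} [DecidableEq V] [Countable V] {G : SimpleGraph V} [G.LocallyFinite] (Φ : PlanarSkeletonNeg G) (t : V)
  (p : unitInterval) (D : DataN V) (g f ex mx : ℕ) (q : unitInterval)

/-- The fields of `SR` (all `rfl`). [folklore] -/
theorem SR_fields : (SR ex mx κ Φ t p D g f q).rmax = max (fcells κ Φ t p D g f).rmax (cOff κ Φ t p D g f + 1) ∧ (SR ex mx κ Φ t p D g f q).u = 1 ∧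
    (SR ex mx κ Φ t p D g f q).M = 0 ∧ (SR ex mx κ Φ t p D g f q).ψM = 0 ∧ (SR ex mx κ Φ t p D g f q).ψtop = 0 ∧ (SR ex mx κ Φ t p D g f q).reachK = ex ∧
    (SR ex mx κ Φ t p D g f q).Rex = Rex κ Φ (mR κ Φ t p D g f mx) q :=
  ⟨rfl, rfl, rfl, rfl, rfl, rfl, rfl⟩

/-- `fcells.rmax ≤ rmax` and `cOff + 1 ≤ rmax`. [folklore] -/
theorem SR_rmax_ge : (fcells κ Φ t p D g f).rmax ≤ (SR ex mx κ Φ t p D g f q).rmax ∧ cOff κ Φ t p D g f + 1 ≤ (SR ex mx κ Φ t p D g f q).rmax :=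
  ⟨le_max_left _ _, le_max_right _ _⟩

/-! ## §2 The gap, `L′`, `E₀` at the value -/

/-- **`20·fcells.rmax ≤ gap ρ`** ((C)'s `hgap`, hp-8's `hgap20`). [folklore] -/
theorem hgap20_R (ρ : ℕ) : 20 * (fcells κ Φ t p D g f).rmax ≤ Skelφ.Prm.gap (SR ex mx κ Φ t p D g f q) ρ :=
  le_trans (Nat.mul_le_mul_left _ (SR_rmax_ge κ Φ t p D g f ex mx q).1) (Skelφ.Prm.twenty_rmax_le_gap _ ρ)

/-- **`cOff ≤ gap ρ`** ((C)'s `hgapc`/`hgapC` with `c := cOff`, hp-8's `hgapc`). [folklore] -/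
theorem hgapc_R (ρ : ℕ) : cOff κ Φ t p D g f ≤ Skelφ.Prm.gap (SR ex mx κ Φ t p D g f q) ρ := by
  have h1 := (SR_rmax_ge κ Φ t p D g f ex mx q).2
  have h2 := Skelφ.Prm.dG_le_gap (SR ex mx κ Φ t p D g f q) ρ
  exact le_trans (le_trans (le_trans (Nat.le_succ _) h1) (Nat.le_mul_of_pos_left _ (by norm_num))) h2

/-- **`cOff + 2L′ + Rex ρ + 2 ≤ gap ρ`** (hp-8's `hgapR` with `R₁ := Rex`; `gap ρ = 2L′ + 1 + Rex (ρ+1) + 100·rmax`, `Rex` monotone, `100·rmax ≥ 100(cOff+1)`). [folklore] -/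
theorem hgapR_R (ρ : ℕ) : cOff κ Φ t p D g f + 2 * Skelφ.Prm.Lp (SR ex mx κ Φ t p D g f q) + Rex κ Φ (mR κ Φ t p D g f mx) q ρ + 2 ≤
    Skelφ.Prm.gap (SR ex mx κ Φ t p D g f q) ρ := by
  rw [Skelφ.Prm.gap_eq]
  have h1 : cOff κ Φ t p D g f + 1 ≤ (SR ex mx κ Φ t p D g f q).rmax := (SR_rmax_ge κ Φ t p D g f ex mx q).2
  have h2 : Rex κ Φ (mR κ Φ t p D g f mx) q ρ ≤ (SR ex mx κ Φ t p D g f q).Rex (ρ + 1) := Rex_mono κ Φ _ q (Nat.le_succ ρ)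
  generalize (SR ex mx κ Φ t p D g f q).rmax = R at h1 ⊢
  generalize (SR ex mx κ Φ t p D g f q).Rex (ρ + 1) = X at h2 ⊢
  generalize Skelφ.Prm.Lp (SR ex mx κ Φ t p D g f q) = L
  omega

/-- `L′ ≤ gap ρ`. [folklore] -/
theorem hgapL_R (ρ : ℕ) : Skelφ.Prm.Lp (SR ex mx κ Φ t p D g f q) ≤ Skelφ.Prm.gap (SR ex mx κ Φ t p D g f q) ρ := Skelφ.Prm.hgapL _ ρ

/-- **The residual floor reaches `L′` and `E₀`**: `ex ≤ L′ ≤ E₀`. [folklore] -/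
theorem ex_le_Lp : ex ≤ Skelφ.Prm.Lp (SR ex mx κ Φ t p D g f q) ∧ Skelφ.Prm.Lp (SR ex mx κ Φ t p D g f q) ≤ Skelφ.Prm.E₀ (SR ex mx κ Φ t p D g f q) := by
  refine ⟨?_, Skelφ.Prm.Lp_le_E₀ _⟩
  have h := Skelφ.Prm.reachK_le_Lp (SR ex mx κ Φ t p D g f q)
  exact h

/-- `3 ≤ E₀` ((C)'s `hE₀`), indeed `45·rmax ≤ E₀` with `rmax ≥ 1`. [folklore] -/
theorem three_le_E₀_R : 3 ≤ Skelφ.Prm.E₀ (SR ex mx κ Φ t p D g f q) ∧ 45 * (fcells κ Φ t p D g f).rmax ≤ Skelφ.Prm.E₀ (SR ex mx κ Φ t p D g f q) := by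
  have h1 := Skelφ.Prm.planar_le_E₀ (SR ex mx κ Φ t p D g f q)
  have h2 := (SR_rmax_ge κ Φ t p D g f ex mx q).1
  have h3 : 1 ≤ (fcells κ Φ t p D g f).rmax := le_trans ((fcells κ Φ t p D g f).one_le_r 0) ((fcells κ Φ t p D g f).r_le_rmax 0)
  have h4 : 45 * (fcells κ Φ t p D g f).rmax ≤ Skelφ.Prm.E₀ (SR ex mx κ Φ t p D g f q) :=
    le_trans (le_trans (Nat.mul_le_mul_left 45 h2) (Nat.le_add_right _ _)) h1
  exact ⟨le_trans (le_trans (by norm_num : 3 ≤ 45 * 1) (Nat.mul_le_mul_left 45 h3)) h4, h4⟩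

/-- **`hsch`**: `Rex (E g' + 1) + L′ ≤ E (g'+1)` for `E := Erad gap 0 E₀` (D″'s `Prm.hsch`, `100·rmax` absorbed). [folklore] -/
theorem hsch_R (g' : ℕ) : Rex κ Φ (mR κ Φ t p D g f mx) q (Erad (Skelφ.Prm.gap (SR ex mx κ Φ t p D g f q)) (fun _ => 0) (Skelφ.Prm.E₀ (SR ex mx κ Φ t p D g f q)) g' + 1) +
      Skelφ.Prm.Lp (SR ex mx κ Φ t p D g f q) ≤ Erad (Skelφ.Prm.gap (SR ex mx κ Φ t p D g f q)) (fun _ => 0) (Skelφ.Prm.E₀ (SR ex mx κ Φ t p D g f q)) (g' + 1) := by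
  have h := Skelφ.Prm.hsch (SR ex mx κ Φ t p D g f q) g'
  exact le_trans (Nat.add_le_add_right (Nat.le_add_right _ _) _) h

/-- `Rex` at the value is monotone ((C)'s excess radius as a function of the entrance depth). [folklore] -/
theorem Rex_mono_R : Monotone (SR ex mx κ Φ t p D g f q).Rex := Rex_monotone κ Φ _ q

/-! ## §3 The excess at the value -/

/-- **`hR₁` at the value** ((F)/(R): depth `ρ+1`, any centre, either orientation, any `η' ≥ η`, planar diameter `mR`) — stated with the consumer's `[DecidableEq V]`
instance inside `Neg.η` (part Excess's `hR₁_at` carries the classical one; the two agree by `Subsingleton.elim`, which `convert` discharges). [folklore] -/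
theorem hR₁_R (hC : Φ.CylSubcritical q) (o : Bool) {η' : ℝ} (hη' : Neg.η κ Φ ≤ η') (c : V) :
    ∀ ρ R', (SR ex mx κ Φ t p D g f q).Rex ρ ≤ R' → ∀ (Rw : ℕ) (D' A' : Finset V), (∀ d ∈ D', d ∈ graphBall G c Rw) →
      (∀ d ∈ D', ∀ d' ∈ D', oriφ Φ.φ o d - oriφ Φ.φ o d' ∈ box 2 (mR κ Φ t p D g f mx)) → A' ⊆ D' → (∀ a ∈ A', a ∈ graphBall G c (ρ + 1)) →
        (bondPercolation G q).real (excess G c R' D' A') ≤ η' := by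
  have hη'' : @Neg.η κ V (fun a b => Classical.propDecidable (a = b)) _ G _ Φ ≤ η' := by convert hη' using 2
  exact hR₁_at κ Φ (mR κ Φ t p D g f mx) hC o hη'' c

/-- **`hRex` at the value** ((C): depth `R₀'`), consumer's instance. [folklore] -/
theorem hRex_R (hC : Φ.CylSubcritical q) (o : Bool) {η' : ℝ} (hη' : Neg.η κ Φ ≤ η') (c : V) :
    ∀ R₀' R₁, (SR ex mx κ Φ t p D g f q).Rex R₀' ≤ R₁ → ∀ (Rw : ℕ) (D' A' : Finset V), (∀ d ∈ D', d ∈ graphBall G c Rw) →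
      (∀ d ∈ D', ∀ d' ∈ D', oriφ Φ.φ o d - oriφ Φ.φ o d' ∈ box 2 (mR κ Φ t p D g f mx)) → A' ⊆ D' → (∀ a ∈ A', a ∈ graphBall G c R₀') →
        (bondPercolation G q).real (excess G c R₁ D' A') ≤ η' := by
  have hη'' : @Neg.η κ V (fun a b => Classical.propDecidable (a = b)) _ G _ Φ ≤ η' := by convert hη' using 2
  exact hRex_at κ Φ (mR κ Φ t p D g f mx) hC o hη'' c

/-- `η ≤ η` across instances: the consumer's `Neg.η`/`Neg.δkit` facts (`η_pos`, `δkit_le_δ`, …) feed `hR₁_R/hRex_R` directly; this records `η ≤ δkit/2`-type uses. [folklore] -/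
theorem hR₁_R_η (hC : Φ.CylSubcritical q) (o : Bool) (c : V) :
    ∀ ρ R', (SR ex mx κ Φ t p D g f q).Rex ρ ≤ R' → ∀ (Rw : ℕ) (D' A' : Finset V), (∀ d ∈ D', d ∈ graphBall G c Rw) →
      (∀ d ∈ D', ∀ d' ∈ D', oriφ Φ.φ o d - oriφ Φ.φ o d' ∈ box 2 (mR κ Φ t p D g f mx)) → A' ⊆ D' → (∀ a ∈ A', a ∈ graphBall G c (ρ + 1)) →
        (bondPercolation G q).real (excess G c R' D' A') ≤ Neg.η κ Φ :=
  hR₁_R κ Φ t p D g f ex mx q hC o le_rfl c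

/-- **FINE DIAMETER ⇒ φ-DIAMETER**: two vertices whose fine coordinates (map slot `φ′`) differ by `≤ 50·fcells.rmax` on both axes have `φ′ d − φ′ d' ∈ box 2 mR` (so the (C)
residue's rim habitats of fine diameter `50·rmax` satisfy `hRex_R`'s box hypothesis at either oriented map `φ′ = oriφ Φ.φ o`). [folklore] -/
theorem fine_diam_le_mR (hN : EqNumL κ Φ t p D g f) {φ' : V → Site 2} {d d' : V}
    (h : fine κ Φ t p D g f φ' d - fine κ Φ t p D g f φ' d' ∈ box 2 (50 * (fcells κ Φ t p D g f).rmax)) : φ' d - φ' d' ∈ box 2 (mR κ Φ t p D g f mx) := by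
  rw [mem_box] at h ⊢
  intro i
  have hρ : ∀ j, |fine κ Φ t p D g f φ' d j - fine κ Φ t p D g f φ' d' j| ≤ ((50 * (fcells κ Φ t p D g f).rmax : ℕ) : ℤ) := fun j => by
    have hj := h j
    rw [Pi.sub_apply] at hj
    exact abs_le.2 hj
  have hK := φ_extent_fine_at κ Φ t p D g f hN (by positivity) hρ i
  have hK1 : (1 : ℤ) ≤ Neg.K κ := by exact_mod_cast (Neg.forty_le_K κ).2.2
  have hm : ((80 * (nL κ Φ t p D g f + ℓL κ Φ t p D g f + 3 * (hL κ Φ t p D g f).natAbs + 1) * (50 * (fcells κ Φ t p D g f).rmax + 1) : ℕ) : ℤ) ≤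
      (mR κ Φ t p D g f mx : ℤ) := by
    exact_mod_cast (mR_ge κ Φ t p D g f mx).1
  have habs : (0 : ℤ) ≤ |φ' d i - φ' d' i| := abs_nonneg _
  have hB : (0 : ℤ) ≤ 80 * ((nL κ Φ t p D g f : ℤ) + ℓL κ Φ t p D g f + 3 * |hL κ Φ t p D g f| + 1) * (((50 * (fcells κ Φ t p D g f).rmax : ℕ) : ℤ) + 1) := by
    positivity
  have h1 : |φ' d i - φ' d' i| ≤ 80 * ((nL κ Φ t p D g f : ℤ) + ℓL κ Φ t p D g f + 3 * |hL κ Φ t p D g f| + 1) * (((50 * (fcells κ Φ t p D g f).rmax : ℕ) : ℤ) + 1) := by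
    nlinarith
  have h2 : 80 * ((nL κ Φ t p D g f : ℤ) + ℓL κ Φ t p D g f + 3 * |hL κ Φ t p D g f| + 1) * (((50 * (fcells κ Φ t p D g f).rmax : ℕ) : ℤ) + 1) =
      ((80 * (nL κ Φ t p D g f + ℓL κ Φ t p D g f + 3 * (hL κ Φ t p D g f).natAbs + 1) * (50 * (fcells κ Φ t p D g f).rmax + 1) : ℕ) : ℤ) := by
    push_cast; ring
  have hm' : 80 * ((nL κ Φ t p D g f : ℤ) + ℓL κ Φ t p D g f + 3 * |hL κ Φ t p D g f| + 1) * (((50 * (fcells κ Φ t p D g f).rmax : ℕ) : ℤ) + 1) ≤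
      (mR κ Φ t p D g f mx : ℤ) := by
    rw [h2]; exact hm
  rw [Pi.sub_apply]
  exact abs_le.1 (h1.trans hm')

end Facts

end NegB

end PlanarSkeletonNeg

end Summit.CriticalPhenomena.PercolationContinuityZ3.Theorems.Transplant

end
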